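import Mathlib.Geometry.Manifold.ContMDiff.Atlas
import Mathlib.Geometry.Manifold.ContMDiff.NormedSpace
import Mathlib.Geometry.Manifold.Instances.Real
import Mathlib.Analysis.InnerProductSpace.PiL2
import HarnessLib

/-!
# The image of a compact manifold under a `C¹` map is thin

Topic `Literature/AlgebraicTopology/FundamentalGroupoid`; the input format of the general
position theorems of `GeneralPositionManifold.lean` /
`ThinComplementSimplyConnected.lean` (M. W. Hirsch, *Differential Topology* (1976), Ch. 3,
Thm. 2.5: sets of measure zero / images of lower-dimensional manifolds can be avoided): a set is
*thin of dimension `d`* there if it is covered by countably many images `G j '' O j` of maps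
`G j : ℝᵈ ⊇ O j → M` which are `C¹` on the open sets `O j`. This file proves that

* `exists_thin_cover_range_of_contMDiff` — the image of a `C¹` map `g : N → M` from a COMPACT
  `C¹` manifold `N` modelled on `ℝᵈ` (e.g. an embedded `d`-sphere) is thin of dimension `d`:
  finitely many charts of `N` cover it, and `g ∘ chart⁻¹` read on `Fin d → ℝ` is `C¹` on the
  chart targets;
* `exists_thin_cover_union` — finite unions of thin sets are thin.

For the `E₈` plumbing (Kosinski, *Differential Manifolds* (1993), VI.12) the eight core
`2m`-spheres of `M(4m)` are thereby thin of dimension `2m`, of codimension `2m ≥ 3` in `M(4m)`.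
Everything is proved; no definitions.

## References

* M. W. Hirsch, *Differential Topology*, GTM 33, Springer (1976), Ch. 3, Thm. 2.5 and §1
  (measure zero). [HirschDT1976]
-/

noncomputable section

open Set Function Topology
open scoped Manifold ContDiff

namespace Literature.AlgebraicTopology.FundamentalGroupoid

variable {E : Type*} [NormedAddCommGroup E] [NormedSpace ℝ E]
  {H : Type*} [TopologicalSpace H] {J : ModelWithCorners ℝ E H}
  {M : Type*} [TopologicalSpace M] [ChartedSpace H M]

/-- **Finite unions of thin sets are thin**: covers by countably many `C¹` images of open subsets
of `ℝᵈ` for `C₁` and `C₂` combine to one for `C₁ ∪ C₂`. [folklore] -/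
theorem exists_thin_cover_union {d : ℕ} {C₁ C₂ : Set M}
    {ι₁ : Type*} [Countable ι₁] (O₁ : ι₁ → Set (Fin d → ℝ)) (G₁ : ι₁ → (Fin d → ℝ) → M)
    (hO₁ : ∀ j, IsOpen (O₁ j)) (hG₁ : ∀ j, ContMDiffOn 𝓘(ℝ, Fin d → ℝ) J 1 (G₁ j) (O₁ j))
    (hC₁ : C₁ ⊆ ⋃ j, G₁ j '' O₁ j)
    {ι₂ : Type*} [Countable ι₂] (O₂ : ι₂ → Set (Fin d → ℝ)) (G₂ : ι₂ → (Fin d → ℝ) → M)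
    (hO₂ : ∀ j, IsOpen (O₂ j)) (hG₂ : ∀ j, ContMDiffOn 𝓘(ℝ, Fin d → ℝ) J 1 (G₂ j) (O₂ j))
    (hC₂ : C₂ ⊆ ⋃ j, G₂ j '' O₂ j) :
    ∃ (O : ι₁ ⊕ ι₂ → Set (Fin d → ℝ)) (G : ι₁ ⊕ ι₂ → (Fin d → ℝ) → M),
      (∀ j, IsOpen (O j)) ∧ (∀ j, ContMDiffOn 𝓘(ℝ, Fin d → ℝ) J 1 (G j) (O j)) ∧
      C₁ ∪ C₂ ⊆ ⋃ j, G j '' O j := by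
  refine ⟨Sum.elim O₁ O₂, Sum.elim G₁ G₂, fun j => ?_, fun j => ?_, ?_⟩
  · cases j with
    | inl j => exact hO₁ j
    | inr j => exact hO₂ j
  · cases j with
    | inl j => exact hG₁ j
    | inr j => exact hG₂ j
  · rintro x (hx | hx)
    · obtain ⟨j, hj⟩ := mem_iUnion.1 (hC₁ hx)
      exact mem_iUnion.2 ⟨Sum.inl j, hj⟩
    · obtain ⟨j, hj⟩ := mem_iUnion.1 (hC₂ hx)
      exact mem_iUnion.2 ⟨Sum.inr j, hj⟩

/-- **The image of a compact `C¹` manifold modelled on `ℝᵈ` under a `C¹` map is thin of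
dimension `d`**: finitely many charts cover the compact `N`, and on the target of each chart
`c` the map `g ∘ c⁻¹`, read on `Fin d → ℝ` through the linear isometry
`EuclideanSpace ℝ (Fin d) ≃ (Fin d → ℝ)`, is `C¹` (Hirsch 1976, Ch. 3 §1: images of manifolds of
smaller dimension have measure zero). [cite: HirschDT1976, Ch. 3 Thm. 2.5] -/
theorem exists_thin_cover_range_of_contMDiff {d : ℕ} {N : Type*} [TopologicalSpace N]
    [CompactSpace N] [ChartedSpace (EuclideanSpace ℝ (Fin d)) N] [IsManifold (𝓡 d) 1 N]
    {g : N → M} (hg : ContMDiff (𝓡 d) J 1 g) :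
    ∃ (m : ℕ) (O : Fin m → Set (Fin d → ℝ)) (G : Fin m → (Fin d → ℝ) → M),
      (∀ j, IsOpen (O j)) ∧ (∀ j, ContMDiffOn 𝓘(ℝ, Fin d → ℝ) J 1 (G j) (O j)) ∧
      range g ⊆ ⋃ j, G j '' O j := by
  classical
  -- finitely many chart sources cover `N`
  obtain ⟨t, ht⟩ := isCompact_univ.elim_finite_subcover
    (fun x : N => (chartAt (EuclideanSpace ℝ (Fin d)) x).source)
    (fun x => (chartAt _ x).open_source) (fun x _ => mem_iUnion.2 ⟨x, mem_chart_source _ x⟩)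
  set L : EuclideanSpace ℝ (Fin d) ≃L[ℝ] (Fin d → ℝ) := EuclideanSpace.equiv (Fin d) ℝ with hL
  set e : Fin t.card ≃ ↥t := t.equivFin.symm with he
  refine ⟨t.card, fun j => L.symm ⁻¹' (chartAt (EuclideanSpace ℝ (Fin d)) (e j : N)).target,
    fun j w => g ((chartAt (EuclideanSpace ℝ (Fin d)) (e j : N)).symm (L.symm w)),
    fun j => (chartAt _ (e j : N)).open_target.preimage L.symm.continuous, fun j => ?_, ?_⟩
  · -- `g ∘ chart⁻¹ ∘ L⁻¹` is `C¹` on `L(chart.target)`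
    have h1 : ContMDiffOn 𝓘(ℝ, Fin d → ℝ) (𝓡 d) 1 (fun w => L.symm w)
        (L.symm ⁻¹' (chartAt (EuclideanSpace ℝ (Fin d)) (e j : N)).target) :=
      ((L.symm : (Fin d → ℝ) →L[ℝ] EuclideanSpace ℝ (Fin d)).contMDiff.of_le
        (by exact_mod_cast le_top)).contMDiffOn
    have h2 : ContMDiffOn (𝓡 d) (𝓡 d) 1 (chartAt (EuclideanSpace ℝ (Fin d)) (e j : N)).symm
        (chartAt (EuclideanSpace ℝ (Fin d)) (e j : N)).target :=
      contMDiffOn_chart_symm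
    exact hg.comp_contMDiffOn (h2.comp h1 fun w hw => hw)
  · -- the cover
    rintro _ ⟨x, rfl⟩
    obtain ⟨y, hyt, hxy⟩ : ∃ y ∈ t, x ∈ (chartAt (EuclideanSpace ℝ (Fin d)) y).source := by
      have := ht (mem_univ x)
      simpa only [mem_iUnion, exists_prop] using this
    refine mem_iUnion.2 ⟨e.symm ⟨y, hyt⟩, ?_⟩
    have hey : (e (e.symm ⟨y, hyt⟩) : N) = y := by rw [Equiv.apply_symm_apply]
    refine ⟨L (chartAt (EuclideanSpace ℝ (Fin d)) y x), ?_, ?_⟩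
    · change L.symm (L _) ∈ (chartAt (EuclideanSpace ℝ (Fin d)) (e (e.symm ⟨y, hyt⟩) : N)).target
      rw [hey, ContinuousLinearEquiv.symm_apply_apply]
      exact (chartAt _ y).map_source hxy
    · change g ((chartAt (EuclideanSpace ℝ (Fin d)) (e (e.symm ⟨y, hyt⟩) : N)).symm
        (L.symm (L _))) = g x
      rw [hey, ContinuousLinearEquiv.symm_apply_apply, (chartAt _ y).left_inv hxy]

end Literature.AlgebraicTopology.FundamentalGroupoid
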